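/-
Copyright (c) 2026 the pub-hodgecm-mathlib formalisation cell (harness21).  Prover seat hodgecm-mathlib-F0P2-p11 (g0) (L1 re-deal s1969∕s1970, LEAD F0P6-plan (g14)
EMIT #1 «p22» (R1-α)), Track B «K2-LIT» ∕ hLiu418 #184♮, ROAD Φ, G5-b = Φ7-3, organ (R1-α), device (b3-i) «the twisted middle term as a `ℙ¹(L)`-indexed orbit sum»
(sequel of ★ p861153 `K2LiuRankOneUnfolding`, ★ p861210 `K2LiuRankOneOrbitTransport`).  THEOREMS ONLY.
-/
import Summits.HodgeConjecture.HodgeConjecture.Theorems.K2LiuRankOneOrbitTransport        -- ★ p861210 (b1): `tsum_orbit_reflStd_siegel_eq_twisted` (+ ★ α3-1, ★ α1)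
import Summits.HodgeConjecture.HodgeConjecture.Theorems.K2LiuConstantTermMiddleCellGL2    -- ★ α3-2: `hasSum_middle_cell` (the `S = 0` model; + ★ α2d-2, ★ α2c)
import HarnessLib

/-!
# Crux `HLiu418`, ROAD Φ, organ Φ7-3 (R1-α), device (b3-i): THE MIDDLE TERM OF THE `S`-th FOURIER COEFFICIENT IS A `ℙ¹(L)`-INDEXED SUM OF TWISTED INNER
# INTEGRALS — `MID_S(h) = Σ_{p ∈ ℙ¹(L)} ∫ β₁(u) • (conj ψ_S(Λ(γp)^⁻¹ u Λ(γp)^) · f(w₀ (u (Λ(γp)^ h)))) dνN(u)` (any index `S`, `n = 2`)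

Cell `hodgecm-mathlib`, crux item hLiu418 = `stmt-HodgeConjecture-24832` (helper lane, count-neutral); squad K2 ∕ K2Liu, LEAD F0P6-plan (g14), desk (R1-α)
K2E5-p17 (g8); prover F0P2-p11 (g0).  THEOREMS ONLY (no `def`, no `instance`, no notation, no named-fact hypothesis, no `sorry`).

WHY.  ★ Φ2 `fourierCoeff_cells_of_ne_one` writes the `S`-th coefficient of `E^Δ(·; f)` along `N_Δ` as `W_S(f)(h) + MID_S(h)`,
`MID_S(h) = ∫ β(u) • (conj ψ_S(u) · Σ_{q ∈ REST} f(γ_q u h)) dνN(u)`.  For `n = 2`, REST `= ⨆_{p ∈ ℙ¹(L)} O(γ p)` with representatives `w₀ Λ(γ p)^` (★ α2d-2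
`rest_eq_iUnion_orbit`, `pairwise_disjoint_orbit`), and each orbit is the twisted inner integral of ★ p861210 `tsum_orbit_reflStd_siegel_eq_twisted` at the rational
Siegel frame `p' = Λ(γ p)^`.  This file is the ψ_S-TWISTED twin of ★ α3-2 `K2LiuConstantTermMiddleCellGL2.hasSum_middle_cell` (the `S = 0` middle cell as a `GL₂` Borel
Eisenstein sum): the same regrouping under (H), the twist being unimodular.
* §1 `integral_wt_smul_conj_mul_tsum_subtype_eq_tsum`, `summable_integral_wt_smul_conj_mul` — Fubini for series under (H) and absolute summability of the twisted
  coset integrals `J_S(q) = ∫ β(u) • (conj ψ_S(u) · f(γ_q u h)) dνN` (twins of ★ α3-1; ★ `enorm_wt_smul_conj_mul`).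
* §2 **`hasSum_middle_cell_twisted`** — `HasSum (p ↦ V_S(p)) (MID_S(h))`, `V_S(p) := ∫ β₁(u) • (conj ψ_S(Λ(γp)^⁻¹ u Λ(γp)^) · f(w₀ (u (Λ(γp)^ h)))) dνN(u)`
  (`Γ₀ = Stab([w₀])`-weight `β₁`, conjugation invariance of `νN` BY VALUE as in ★ α3-2); **`middle_cell_eq_tsum_twisted`** (`tsum` ∕ `Summable` reading).
For a RANK-ONE `T_L`-skew `S` every `V_S(p)` with `p ≠ [ker-line of S]` dies (★ criterion `tsum_middle_orbit_eq_zero_of_ne_corner`) and the surviving one unfolds along the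
corner line by ★ p861210 `exists_corner_unfold_char_section` ∕ `conj_unipDeltaChar_conj_invariant` — device (b3-ii), the sequel.
References: [MoeglinWaldspurger1995] II.1.7; [KudlaRallis1994] §2 (2.10)–(2.12); [Shimura1997] §18.3; [Tan1999] §3; [GelbartPiatetskishapiroRallis1987] Part A §2;
[Garrett2018] §3.10.
HONEST LABEL.  Count-neutral helper: `HC_CM` is proved only modulo the 7 printed citations (2 remaining named inputs: hLiu418 = `stmt-HodgeConjecture-24832`,
h413 = `stmt-HodgeConjecture-24833`) until rung 0 closes.
-/

set_option autoImplicit false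
set_option linter.dupNamespace false -- the mandated namespace repeats `HodgeConjecture.HodgeConjecture`

noncomputable section

open scoped Matrix ENNReal NNReal ComplexConjugate
open NumberField IsDedekindDomain MeasureTheory MeasureTheory.Measure Filter Set Function
open Literature.NumberTheory.Automorphic Literature.NumberTheory.Automorphic.UnitaryGroup Literature.NumberTheory.GaloisRepresentations
open Literature.NumberTheory.GelbartRogawski1991 Literature.NumberTheory.GelbartRogawski1991.GRConstruction
open Literature.NumberTheory.GelbartRogawski1991.AdaptedBlocks
open Literature.NumberTheory.K2Lit.SiegelDoubled Literature.MeasureTheory.Group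
open UnitaryDualPair

namespace Summit.HodgeConjecture.HodgeConjecture.Cruxes.HLiu418.K2LiuRankOneMiddleOrbitSum

open K2LiuUnipotentCoveringWeight K2LiuConstantTermBigCellUnfold K2LiuSiegelDoubledUnfold K2LiuSiegelUnipotentFourierDefs K2LiuSiegelUnipotentCharacters
  K2LiuSiegelEisensteinCoeffCells K2LiuSiegelEisensteinCoeffOrbitSum K2LiuSiegelBruhatMiddleCellDelta K2LiuSiegelLeviConjUnipDeltaChar
  K2LiuSiegelRationalLeviDecomposition K2LiuConstantTermMiddleCellOrbits K2LiuConstantTermMiddleCellPrelims K2LiuConstantTermMiddleCellGL2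
  K2LiuSiegelMiddleCellLeviCriterion K2LiuRankOneOrbitTransport

variable {L : Type} [Field L] [NumberField L] [IsCMField L]

/-! ## §1 Fubini for series under (H), twisted -/

section General

variable {N M n : ℕ} {e : Fin N × Fin M ≃ Fin n}
  {dV : Fin N → L} {hdV : ∀ i, IsCMField.complexConj L (dV i) = dV i}
  {dW : Fin M → L} {hdW : ∀ i, IsCMField.complexConj L (dW i) = dW i}
variable [MeasurableSpace (unipDelta L e dV hdV dW hdW)] [BorelSpace (unipDelta L e dV hdV dW hdW)]

/-- **Fubini for series under (H), twisted, on any set of cosets**: `∫ β(u) • (conj ψ_S(u) · Σ_{q ∈ R} f(γ_q u h)) dνN = Σ_{q ∈ R} ∫ β(u) • (conj ψ_S(u) · f(γ_q u h)) dνN`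
(the twist is unimodular, ★ `enorm_wt_smul_conj_mul`; twin of ★ α3-1 `integral_wt_smul_tsum_subtype_eq_tsum`). [cite: MoeglinWaldspurger1995, II.1.7] [cite: Garrett2018, §3.10] -/
theorem integral_wt_smul_conj_mul_tsum_subtype_eq_tsum (νN : Measure (unipDelta L e dV hdV dW hdW)) [νN.IsMulLeftInvariant]
    {β : unipDelta L e dV hdV dW hdW → ℝ≥0∞} (hβ : IsCoveringWeight (unipDeltaRat L e dV hdV dW hdW) β) {f : HA L e dV hdV dW hdW → ℂ} (hfc : Continuous f)
    (h : HA L e dV hdV dW hdW)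
    (hH : ∫⁻ u, (∑' q : SiegelDeltaQuot L e dV hdV dW hdW,
        ‖f ((((Quotient.out q : ratH L e dV hdV dW hdW) : HA L e dV hdV dW hdW)) * ((u : HA L e dV hdV dW hdW) * h))‖ₑ) * β u ∂νN ≠ ∞)
    (S : Matrix (Fin n) (Fin n) L) (R : Set (SiegelDeltaQuot L e dV hdV dW hdW)) :
    ∫ u, (β u).toReal • (conj (unipDeltaChar L e dV hdV dW hdW S (u : HA L e dV hdV dW hdW) : ℂ) *
        (∑' q : ↥R, f ((((Quotient.out (q : SiegelDeltaQuot L e dV hdV dW hdW) : ratH L e dV hdV dW hdW) : HA L e dV hdV dW hdW)) * ((u : HA L e dV hdV dW hdW) * h)))) ∂νN =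
      ∑' q : ↥R, ∫ u, (β u).toReal • (conj (unipDeltaChar L e dV hdV dW hdW S (u : HA L e dV hdV dW hdW) : ℂ) *
        f ((((Quotient.out (q : SiegelDeltaQuot L e dV hdV dW hdW) : ratH L e dV hdV dW hdW) : HA L e dV hdV dW hdW)) * ((u : HA L e dV hdV dW hdW) * h))) ∂νN := by
  haveI : Countable (unipDeltaRat L e dV hdV dW hdW) := countable_unipDeltaRat L e dV hdV dW hdW
  haveI : Countable (ratH L e dV hdV dW hdW) := countable_ratH L e dV hdV dW hdW
  haveI : Countable (SiegelDeltaQuot L e dV hdV dW hdW) := by unfold SiegelDeltaQuot; exact inferInstance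
  have hgm : ∀ q : SiegelDeltaQuot L e dV hdV dW hdW, AEStronglyMeasurable (fun u : unipDelta L e dV hdV dW hdW =>
      (β u).toReal • (conj (unipDeltaChar L e dV hdV dW hdW S (u : HA L e dV hdV dW hdW) : ℂ) *
        f ((((Quotient.out q : ratH L e dV hdV dW hdW) : HA L e dV hdV dW hdW)) * ((u : HA L e dV hdV dW hdW) * h)))) νN :=
    fun q => aestronglyMeasurable_wt_smul_conj_mul_apply νN hβ.1 S hfc _ h
  have hsum : ∑' q : SiegelDeltaQuot L e dV hdV dW hdW, ∫⁻ u, ‖(β u).toReal • (conj (unipDeltaChar L e dV hdV dW hdW S (u : HA L e dV hdV dW hdW) : ℂ) *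
      f ((((Quotient.out q : ratH L e dV hdV dW hdW) : HA L e dV hdV dW hdW)) * ((u : HA L e dV hdV dW hdW) * h)))‖ₑ ∂νN ≠ ∞ := by
    simp_rw [enorm_wt_smul_conj_mul hβ S]
    rw [← lintegral_tsum (f := fun (q : SiegelDeltaQuot L e dV hdV dW hdW) (u : unipDelta L e dV hdV dW hdW) =>
        ‖f ((((Quotient.out q : ratH L e dV hdV dW hdW) : HA L e dV hdV dW hdW)) * ((u : HA L e dV hdV dW hdW) * h))‖ₑ * β u)
      fun q => ((measurable_enorm_apply_mul_coe_mul' hfc _ h).mul hβ.1).aemeasurable]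
    simp_rw [ENNReal.tsum_mul_right]
    exact hH
  have hsumR : ∑' q : ↥R, ∫⁻ u, ‖(β u).toReal • (conj (unipDeltaChar L e dV hdV dW hdW S (u : HA L e dV hdV dW hdW) : ℂ) *
      f ((((Quotient.out (q : SiegelDeltaQuot L e dV hdV dW hdW) : ratH L e dV hdV dW hdW) : HA L e dV hdV dW hdW)) * ((u : HA L e dV hdV dW hdW) * h)))‖ₑ ∂νN ≠ ∞ :=
    ne_top_of_le_ne_top hsum (ENNReal.tsum_comp_le_tsum_of_injective Subtype.val_injective _)
  rw [← integral_tsum (fun q : ↥R => hgm q) hsumR]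
  refine integral_congr_ae (ae_of_all _ fun u => ?_)
  show (β u).toReal • (conj (unipDeltaChar L e dV hdV dW hdW S (u : HA L e dV hdV dW hdW) : ℂ) *
      (∑' q : ↥R, f ((((Quotient.out (q : SiegelDeltaQuot L e dV hdV dW hdW) : ratH L e dV hdV dW hdW) : HA L e dV hdV dW hdW)) * ((u : HA L e dV hdV dW hdW) * h)))) =
    ∑' q : ↥R, (β u).toReal • (conj (unipDeltaChar L e dV hdV dW hdW S (u : HA L e dV hdV dW hdW) : ℂ) *
      f ((((Quotient.out (q : SiegelDeltaQuot L e dV hdV dW hdW) : ratH L e dV hdV dW hdW) : HA L e dV hdV dW hdW)) * ((u : HA L e dV hdV dW hdW) * h)))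
  rw [tsum_const_smul'' (β u).toReal, tsum_mul_left]

/-- **the twisted coset integrals `J_S(q) = ∫ β(u) • (conj ψ_S(u) · f(γ_q u h)) dνN` are absolutely summable under (H)** (`‖J_S(q)‖ ≤ ∫⁻ ‖f(γ_q u h)‖ₑ β`; twin of ★ α3-1
`summable_integral_wt_smul`). [cite: MoeglinWaldspurger1995, II.1.7] [cite: Garrett2018, §3.10] -/
theorem summable_integral_wt_smul_conj_mul (νN : Measure (unipDelta L e dV hdV dW hdW)) [νN.IsMulLeftInvariant]
    {β : unipDelta L e dV hdV dW hdW → ℝ≥0∞} (hβ : IsCoveringWeight (unipDeltaRat L e dV hdV dW hdW) β) {f : HA L e dV hdV dW hdW → ℂ} (hfc : Continuous f)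
    (h : HA L e dV hdV dW hdW)
    (hH : ∫⁻ u, (∑' q : SiegelDeltaQuot L e dV hdV dW hdW,
        ‖f ((((Quotient.out q : ratH L e dV hdV dW hdW) : HA L e dV hdV dW hdW)) * ((u : HA L e dV hdV dW hdW) * h))‖ₑ) * β u ∂νN ≠ ∞)
    (S : Matrix (Fin n) (Fin n) L) :
    Summable (fun q : SiegelDeltaQuot L e dV hdV dW hdW => ∫ u, (β u).toReal • (conj (unipDeltaChar L e dV hdV dW hdW S (u : HA L e dV hdV dW hdW) : ℂ) *
      f ((((Quotient.out q : ratH L e dV hdV dW hdW) : HA L e dV hdV dW hdW)) * ((u : HA L e dV hdV dW hdW) * h))) ∂νN) := by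
  haveI : Countable (unipDeltaRat L e dV hdV dW hdW) := countable_unipDeltaRat L e dV hdV dW hdW
  haveI : Countable (ratH L e dV hdV dW hdW) := countable_ratH L e dV hdV dW hdW
  haveI : Countable (SiegelDeltaQuot L e dV hdV dW hdW) := by unfold SiegelDeltaQuot; exact inferInstance
  have hsum : ∑' q : SiegelDeltaQuot L e dV hdV dW hdW, ∫⁻ u, ‖(β u).toReal • (conj (unipDeltaChar L e dV hdV dW hdW S (u : HA L e dV hdV dW hdW) : ℂ) *
      f ((((Quotient.out q : ratH L e dV hdV dW hdW) : HA L e dV hdV dW hdW)) * ((u : HA L e dV hdV dW hdW) * h)))‖ₑ ∂νN ≠ ∞ := by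
    simp_rw [enorm_wt_smul_conj_mul hβ S]
    rw [← lintegral_tsum (f := fun (q : SiegelDeltaQuot L e dV hdV dW hdW) (u : unipDelta L e dV hdV dW hdW) =>
        ‖f ((((Quotient.out q : ratH L e dV hdV dW hdW) : HA L e dV hdV dW hdW)) * ((u : HA L e dV hdV dW hdW) * h))‖ₑ * β u)
      fun q => ((measurable_enorm_apply_mul_coe_mul' hfc _ h).mul hβ.1).aemeasurable]
    simp_rw [ENNReal.tsum_mul_right]
    exact hH
  refine Summable.of_norm_bounded (ENNReal.summable_toReal hsum) fun q => ?_
  rw [← toReal_enorm (∫ u, (β u).toReal • (conj (unipDeltaChar L e dV hdV dW hdW S (u : HA L e dV hdV dW hdW) : ℂ) *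
    f ((((Quotient.out q : ratH L e dV hdV dW hdW) : HA L e dV hdV dW hdW)) * ((u : HA L e dV hdV dW hdW) * h))) ∂νN)]
  exact ENNReal.toReal_mono (ENNReal.ne_top_of_tsum_ne_top hsum q) (enorm_integral_le_lintegral_enorm _)

end General

/-! ## §2 `n = 2`: the twisted middle term is the `ℙ¹(L)`-indexed sum of the twisted inner integrals of the orbits -/

section Two

variable {N M : ℕ} {e : Fin N × Fin M ≃ Fin 2}
  {dV : Fin N → L} {hdV : ∀ i, IsCMField.complexConj L (dV i) = dV i}
  {dW : Fin M → L} {hdW : ∀ i, IsCMField.complexConj L (dW i) = dW i}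
variable [MeasurableSpace (unipDelta L e dV hdV dW hdW)] [BorelSpace (unipDelta L e dV hdV dW hdW)]

variable {g₀ : UnitaryGroup.rationalPair (Fp L) L (IsCMField.complexConj L) N M (Matrix.diagonal dV) (Matrix.diagonal dW)}
  (hg₀ : ((g₀ : GL (Fin N × Fin M) L) : Matrix (Fin N × Fin M) (Fin N × Fin M) L) = Matrix.diagonal (fun k => 1 - 2 * (![0, 1] : Fin 2 → L) (e k)))
  (Λ : GL (Fin 2) (AdeleRing (𝓞 L) L) →* HA L e dV hdV dW hdW)
  (hΛ : ∀ g : GL (Fin 2) (AdeleRing (𝓞 L) L), blk L e dV hdV dW hdW (Λ g) =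
    cayR (AdeleRing (𝓞 L) L) (Fin 2) * Matrix.fromBlocks (g : Matrix (Fin 2) (Fin 2) (AdeleRing (𝓞 L) L)) 0 0
      (((gramR L e dV hdV dW hdW).map ((algebraMap L (AdeleRing (𝓞 L) L)).comp (algebraMap (Fp L) L)))⁻¹ *
        (((g⁻¹ : GL (Fin 2) (AdeleRing (𝓞 L) L)) : Matrix (Fin 2) (Fin 2) (AdeleRing (𝓞 L) L)).map
          (conjAdele (Fp L) L (IsCMField.complexConj L)))ᵀ *
        (gramR L e dV hdV dW hdW).map ((algebraMap L (AdeleRing (𝓞 L) L)).comp (algebraMap (Fp L) L))) *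
      cayRinv (AdeleRing (𝓞 L) L) (Fin 2))
  (Γ₀ : Subgroup (unipDelta L e dV hdV dW hdW))
  (hΓ₀ : ∀ u : unipDelta L e dV hdV dW hdW, u ∈ Γ₀ ↔ (u : HA L e dV hdV dW hdW) ∈ ratH L e dV hdV dW hdW ∧
    IsSiegelDelta L e dV hdV dW hdW (iotaGG L e dV hdV dW hdW (1, UnitaryGroup.rationalPairToAdelic (Fp L) L (IsCMField.complexConj L) N M (Matrix.diagonal dV) (Matrix.diagonal dW) g₀) * (u : HA L e dV hdV dW hdW) * (iotaGG L e dV hdV dW hdW (1, UnitaryGroup.rationalPairToAdelic (Fp L) L (IsCMField.complexConj L) N M (Matrix.diagonal dV) (Matrix.diagonal dW) g₀))⁻¹))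
  (wq : unipDeltaRat L e dV hdV dW hdW → ratH L e dV hdV dW hdW)
  (hwq : ∀ ν, ((wq ν : ratH L e dV hdV dW hdW) : HA L e dV hdV dW hdW) =
    weylDelta L e dV hdV dW hdW * ((ν : unipDelta L e dV hdV dW hdW) : HA L e dV hdV dW hdW))

include hwq hg₀ hΛ hΓ₀ in
/-- **THE TWISTED MIDDLE TERM IS A `ℙ¹(L)`-INDEXED ORBIT SUM.**  `n = 2`; `νN` left-invariant on `N_Δ(𝔸)` and invariant under the conjugations `u ↦ Λĝ u Λĝ⁻¹`,
`g ∈ GL₂(L)` (BY VALUE, as in ★ α3-2); `β` an `N_Δ(L⁺)`-covering weight; `f` a continuous Siegel section of `I_Δ(s, χ)` with the absolute-convergence hypothesis (H) at `h`;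
`Γ₀ = Stab([w₀])` with a covering weight `β₁`; `S` ANY index; `γ` a row section `ℙ(L²) → GL₂(L)`.  THEN
  `HasSum (p ↦ ∫ β₁(u) • (conj ψ_S(Λ(γp)^⁻¹ u Λ(γp)^) · f(w₀ (u (Λ(γp)^ h)))) dνN(u)) (∫ β(u) • (conj ψ_S(u) · Σ_{q ∈ REST} f(γ_q (u h))) dνN(u))`
— REST `= ⨆_p O(γ p)` (★ α2d-2), §1, and the orbit values ★ p861210 `tsum_orbit_reflStd_siegel_eq_twisted` at `p' = Λ(γ p)^`. [cite: MoeglinWaldspurger1995, II.1.7]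
[cite: KudlaRallis1994, §2 (2.10)–(2.12)] [cite: Shimura1997, §18.3] [cite: GelbartPiatetskishapiroRallis1987, Part A §2] -/
theorem hasSum_middle_cell_twisted (hdV0 : ∀ i, dV i ≠ 0) (hdW0 : ∀ i, dW i ≠ 0) (νN : Measure (unipDelta L e dV hdV dW hdW)) [νN.IsMulLeftInvariant]
    {β : unipDelta L e dV hdV dW hdW → ℝ≥0∞} (hβ : IsCoveringWeight (unipDeltaRat L e dV hdV dW hdW) β)
    {χ : HeckeCharacter L} {s : ℂ} {f : HA L e dV hdV dW hdW → ℂ} (hf : IsSiegelDeltaSection L e dV hdV dW hdW χ s f) (hfc : Continuous f)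
    (h : HA L e dV hdV dW hdW)
    (hH : ∫⁻ u, (∑' q : SiegelDeltaQuot L e dV hdV dW hdW,
        ‖f ((((Quotient.out q : ratH L e dV hdV dW hdW) : HA L e dV hdV dW hdW)) * ((u : HA L e dV hdV dW hdW) * h))‖ₑ) * β u ∂νN ≠ ∞)
    {β₁ : unipDelta L e dV hdV dW hdW → ℝ≥0∞} (hβ₁ : IsCoveringWeight Γ₀ β₁)
    (hconj : ∀ g : GL (Fin 2) L, MeasurePreserving (fun u : unipDelta L e dV hdV dW hdW =>
      (⟨Λ (Matrix.GeneralLinearGroup.map (algebraMap L (AdeleRing (𝓞 L) L)) g) * (u : HA L e dV hdV dW hdW) *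
          (Λ (Matrix.GeneralLinearGroup.map (algebraMap L (AdeleRing (𝓞 L) L)) g))⁻¹,
        conj_levi_mem_unipDelta L e dV hdV dW hdW Λ hΛ _ u.2⟩ : unipDelta L e dV hdV dW hdW)) νN νN)
    (S : Matrix (Fin 2) (Fin 2) L)
    (γ : Projectivization L (Fin 2 → L) → GL (Fin 2) L)
    (hγ : ∀ p, Projectivization.mk L ((γ p : Matrix (Fin 2) (Fin 2) L) 1) (row_ne_zero (γ p) 1) = p) :
    HasSum (fun p : Projectivization L (Fin 2 → L) => ∫ u, (β₁ u).toReal •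
        (conj (unipDeltaChar L e dV hdV dW hdW S ((Λ (Matrix.GeneralLinearGroup.map (algebraMap L (AdeleRing (𝓞 L) L)) (γ p)))⁻¹ * (u : HA L e dV hdV dW hdW) *
            Λ (Matrix.GeneralLinearGroup.map (algebraMap L (AdeleRing (𝓞 L) L)) (γ p))) : ℂ) *
          f (iotaGG L e dV hdV dW hdW (1, UnitaryGroup.rationalPairToAdelic (Fp L) L (IsCMField.complexConj L) N M (Matrix.diagonal dV) (Matrix.diagonal dW) g₀) *
            ((u : HA L e dV hdV dW hdW) * (Λ (Matrix.GeneralLinearGroup.map (algebraMap L (AdeleRing (𝓞 L) L)) (γ p)) * h)))) ∂νN)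
      (∫ u, (β u).toReal • (conj (unipDeltaChar L e dV hdV dW hdW S (u : HA L e dV hdV dW hdW) : ℂ) *
          (∑' q : ↥(({Quotient.mk (MulAction.orbitRel (siegelDeltaRat L e dV hdV dW hdW) (ratH L e dV hdV dW hdW)) 1} ∪
            Set.range (fun ν : unipDeltaRat L e dV hdV dW hdW =>
              (Quotient.mk (MulAction.orbitRel (siegelDeltaRat L e dV hdV dW hdW) (ratH L e dV hdV dW hdW)) (wq ν) :
                SiegelDeltaQuot L e dV hdV dW hdW)))ᶜ : Set (SiegelDeltaQuot L e dV hdV dW hdW)),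
          f ((((Quotient.out (q : SiegelDeltaQuot L e dV hdV dW hdW) : ratH L e dV hdV dW hdW) : HA L e dV hdV dW hdW)) *
            ((u : HA L e dV hdV dW hdW) * h)))) ∂νN) := by
  have hγ₀ : ∀ p : Projectivization L (Fin 2 → L),
      iotaGG L e dV hdV dW hdW (1, UnitaryGroup.rationalPairToAdelic (Fp L) L (IsCMField.complexConj L) N M (Matrix.diagonal dV) (Matrix.diagonal dW) g₀) *
        Λ (Matrix.GeneralLinearGroup.map (algebraMap L (AdeleRing (𝓞 L) L)) (γ p)) ∈ ratH L e dV hdV dW hdW := fun p =>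
    mul_mem (iotaGG_one_mem_ratH L e dV hdV dW hdW g₀) (levi_map_mem_ratH L e dV hdV dW hdW Λ hΛ hdV0 hdW0 (γ p))
  have hRO := rest_eq_iUnion_orbit wq hwq hg₀ Λ hΛ hdV0 hdW0 γ hγ hγ₀
  have hdisj : Pairwise (Disjoint on fun p : Projectivization L (Fin 2 → L) => Set.range (fun ν : unipDeltaRat L e dV hdV dW hdW =>
        (Quotient.mk (MulAction.orbitRel (siegelDeltaRat L e dV hdV dW hdW) (ratH L e dV hdV dW hdW))
          ((⟨_, hγ₀ p⟩ : ratH L e dV hdV dW hdW) * ⟨((ν : unipDelta L e dV hdV dW hdW) : HA L e dV hdV dW hdW), coe_mem_ratH ν⟩)))) :=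
    fun p p' hpp' => pairwise_disjoint_orbit hg₀ Λ hΛ γ hγ hγ₀ hpp'
  have hOp : ∀ p : Projectivization L (Fin 2 → L), ∫⁻ u, (∑' q : ↥(Set.range (fun ν : unipDeltaRat L e dV hdV dW hdW =>
        (Quotient.mk (MulAction.orbitRel (siegelDeltaRat L e dV hdV dW hdW) (ratH L e dV hdV dW hdW))
          ((⟨_, hγ₀ p⟩ : ratH L e dV hdV dW hdW) * ⟨((ν : unipDelta L e dV hdV dW hdW) : HA L e dV hdV dW hdW), coe_mem_ratH ν⟩)))),
        ‖f (((Quotient.out q.1 : ratH L e dV hdV dW hdW) : HA L e dV hdV dW hdW) * ((u : HA L e dV hdV dW hdW) * h))‖ₑ) * β u ∂νN ≠ ∞ := by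
    intro p
    refine ne_top_of_le_ne_top hH (lintegral_mono fun u => mul_le_mul' ?_ le_rfl)
    exact ENNReal.tsum_comp_le_tsum_of_injective Subtype.val_injective
      (fun q : SiegelDeltaQuot L e dV hdV dW hdW => ‖f ((((Quotient.out q : ratH L e dV hdV dW hdW) : HA L e dV hdV dW hdW)) * ((u : HA L e dV hdV dW hdW) * h))‖ₑ)
  have key := hasSum_tsum_subtype_of_eq_iUnion (summable_integral_wt_smul_conj_mul νN hβ hfc h hH S) hRO hdisj
  rw [integral_wt_smul_conj_mul_tsum_subtype_eq_tsum νN hβ hfc h hH S]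
  have hfun : (fun p : Projectivization L (Fin 2 → L) => ∫ u, (β₁ u).toReal •
        (conj (unipDeltaChar L e dV hdV dW hdW S ((Λ (Matrix.GeneralLinearGroup.map (algebraMap L (AdeleRing (𝓞 L) L)) (γ p)))⁻¹ * (u : HA L e dV hdV dW hdW) *
            Λ (Matrix.GeneralLinearGroup.map (algebraMap L (AdeleRing (𝓞 L) L)) (γ p))) : ℂ) *
          f (iotaGG L e dV hdV dW hdW (1, UnitaryGroup.rationalPairToAdelic (Fp L) L (IsCMField.complexConj L) N M (Matrix.diagonal dV) (Matrix.diagonal dW) g₀) *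
            ((u : HA L e dV hdV dW hdW) * (Λ (Matrix.GeneralLinearGroup.map (algebraMap L (AdeleRing (𝓞 L) L)) (γ p)) * h)))) ∂νN) =
      fun p : Projectivization L (Fin 2 → L) => ∑' q : ↥(Set.range (fun ν : unipDeltaRat L e dV hdV dW hdW =>
        (Quotient.mk (MulAction.orbitRel (siegelDeltaRat L e dV hdV dW hdW) (ratH L e dV hdV dW hdW))
          ((⟨_, hγ₀ p⟩ : ratH L e dV hdV dW hdW) * ⟨((ν : unipDelta L e dV hdV dW hdW) : HA L e dV hdV dW hdW), coe_mem_ratH ν⟩)))),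
        ∫ u, (β u).toReal • (conj (unipDeltaChar L e dV hdV dW hdW S (u : HA L e dV hdV dW hdW) : ℂ) *
          f (((Quotient.out q.1 : ratH L e dV hdV dW hdW) : HA L e dV hdV dW hdW) * ((u : HA L e dV hdV dW hdW) * h))) ∂νN :=
    funext fun p => (tsum_orbit_reflStd_siegel_eq_twisted Γ₀ hΓ₀ νN hβ hf hfc h hβ₁ (levi_map_mem_ratH L e dV hdV dW hdW Λ hΛ hdV0 hdW0 (γ p))
      (isSiegelDelta_levi_apply L e dV hdV dW hdW Λ hΛ _) (hconj (γ p)) S (hγ₀ p) (hOp p)).symm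
  rw [hfun]
  exact key

include hwq hg₀ hΛ hΓ₀ in
/-- **`MID_S(h) = Σ_{p ∈ ℙ¹(L)} V_S(p)`** and the sum converges absolutely — the `tsum` ∕ `Summable` reading of `hasSum_middle_cell_twisted`
(`V_S(p) = ∫ β₁(u) • (conj ψ_S(Λ(γp)^⁻¹ u Λ(γp)^) · f(w₀ (u (Λ(γp)^ h)))) dνN(u)`). [cite: MoeglinWaldspurger1995, II.1.7] [cite: KudlaRallis1994, §2 (2.10)–(2.12)] -/
theorem middle_cell_eq_tsum_twisted (hdV0 : ∀ i, dV i ≠ 0) (hdW0 : ∀ i, dW i ≠ 0) (νN : Measure (unipDelta L e dV hdV dW hdW)) [νN.IsMulLeftInvariant]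
    {β : unipDelta L e dV hdV dW hdW → ℝ≥0∞} (hβ : IsCoveringWeight (unipDeltaRat L e dV hdV dW hdW) β)
    {χ : HeckeCharacter L} {s : ℂ} {f : HA L e dV hdV dW hdW → ℂ} (hf : IsSiegelDeltaSection L e dV hdV dW hdW χ s f) (hfc : Continuous f)
    (h : HA L e dV hdV dW hdW)
    (hH : ∫⁻ u, (∑' q : SiegelDeltaQuot L e dV hdV dW hdW,
        ‖f ((((Quotient.out q : ratH L e dV hdV dW hdW) : HA L e dV hdV dW hdW)) * ((u : HA L e dV hdV dW hdW) * h))‖ₑ) * β u ∂νN ≠ ∞)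
    {β₁ : unipDelta L e dV hdV dW hdW → ℝ≥0∞} (hβ₁ : IsCoveringWeight Γ₀ β₁)
    (hconj : ∀ g : GL (Fin 2) L, MeasurePreserving (fun u : unipDelta L e dV hdV dW hdW =>
      (⟨Λ (Matrix.GeneralLinearGroup.map (algebraMap L (AdeleRing (𝓞 L) L)) g) * (u : HA L e dV hdV dW hdW) *
          (Λ (Matrix.GeneralLinearGroup.map (algebraMap L (AdeleRing (𝓞 L) L)) g))⁻¹,
        conj_levi_mem_unipDelta L e dV hdV dW hdW Λ hΛ _ u.2⟩ : unipDelta L e dV hdV dW hdW)) νN νN)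
    (S : Matrix (Fin 2) (Fin 2) L)
    (γ : Projectivization L (Fin 2 → L) → GL (Fin 2) L)
    (hγ : ∀ p, Projectivization.mk L ((γ p : Matrix (Fin 2) (Fin 2) L) 1) (row_ne_zero (γ p) 1) = p) :
    ∫ u, (β u).toReal • (conj (unipDeltaChar L e dV hdV dW hdW S (u : HA L e dV hdV dW hdW) : ℂ) *
          (∑' q : ↥(({Quotient.mk (MulAction.orbitRel (siegelDeltaRat L e dV hdV dW hdW) (ratH L e dV hdV dW hdW)) 1} ∪
            Set.range (fun ν : unipDeltaRat L e dV hdV dW hdW =>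
              (Quotient.mk (MulAction.orbitRel (siegelDeltaRat L e dV hdV dW hdW) (ratH L e dV hdV dW hdW)) (wq ν) :
                SiegelDeltaQuot L e dV hdV dW hdW)))ᶜ : Set (SiegelDeltaQuot L e dV hdV dW hdW)),
          f ((((Quotient.out (q : SiegelDeltaQuot L e dV hdV dW hdW) : ratH L e dV hdV dW hdW) : HA L e dV hdV dW hdW)) *
            ((u : HA L e dV hdV dW hdW) * h)))) ∂νN =
      ∑' p : Projectivization L (Fin 2 → L), ∫ u, (β₁ u).toReal •
        (conj (unipDeltaChar L e dV hdV dW hdW S ((Λ (Matrix.GeneralLinearGroup.map (algebraMap L (AdeleRing (𝓞 L) L)) (γ p)))⁻¹ * (u : HA L e dV hdV dW hdW) *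
            Λ (Matrix.GeneralLinearGroup.map (algebraMap L (AdeleRing (𝓞 L) L)) (γ p))) : ℂ) *
          f (iotaGG L e dV hdV dW hdW (1, UnitaryGroup.rationalPairToAdelic (Fp L) L (IsCMField.complexConj L) N M (Matrix.diagonal dV) (Matrix.diagonal dW) g₀) *
            ((u : HA L e dV hdV dW hdW) * (Λ (Matrix.GeneralLinearGroup.map (algebraMap L (AdeleRing (𝓞 L) L)) (γ p)) * h)))) ∂νN ∧
    Summable (fun p : Projectivization L (Fin 2 → L) => ∫ u, (β₁ u).toReal •
        (conj (unipDeltaChar L e dV hdV dW hdW S ((Λ (Matrix.GeneralLinearGroup.map (algebraMap L (AdeleRing (𝓞 L) L)) (γ p)))⁻¹ * (u : HA L e dV hdV dW hdW) *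
            Λ (Matrix.GeneralLinearGroup.map (algebraMap L (AdeleRing (𝓞 L) L)) (γ p))) : ℂ) *
          f (iotaGG L e dV hdV dW hdW (1, UnitaryGroup.rationalPairToAdelic (Fp L) L (IsCMField.complexConj L) N M (Matrix.diagonal dV) (Matrix.diagonal dW) g₀) *
            ((u : HA L e dV hdV dW hdW) * (Λ (Matrix.GeneralLinearGroup.map (algebraMap L (AdeleRing (𝓞 L) L)) (γ p)) * h)))) ∂νN) :=
  ⟨(hasSum_middle_cell_twisted hg₀ Λ hΛ Γ₀ hΓ₀ wq hwq hdV0 hdW0 νN hβ hf hfc h hH hβ₁ hconj S γ hγ).tsum_eq.symm,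
    (hasSum_middle_cell_twisted hg₀ Λ hΛ Γ₀ hΓ₀ wq hwq hdV0 hdW0 νN hβ hf hfc h hH hβ₁ hconj S γ hγ).summable⟩

end Two

end Summit.HodgeConjecture.HodgeConjecture.Cruxes.HLiu418.K2LiuRankOneMiddleOrbitSum

end
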